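import Summits.QuantumFields.YangMills.Theses.RandomConstraintAnnealing
import Literature.MathematicalPhysics.QuantumFieldTheory.LatticeGaugeProofs
import Literature.RepresentationTheory.CompactGroups.UnitaryTrick
import HarnessLib

/-!
# Edwards–Sokal disintegration of the Wilson measure (route `RandomConstraintAnnealing`, item stmt-QuantumFields-8719)

`RandomConstraintAnnealing.EdwardsSokalDisintegration` (support, provable-now): for every torus `(ℤ/L)^d`, compact
second-countable group `G`, continuous matrix representation `ρ`, `β > 0` and bounded measurable `F`,
`∫ F dμ_{Wilson} = ∫ (∫ F d Haar[· | tube c]) d(ρ'/ρ'(univ))(c)` with `0 < ρ'(univ) < ∞`, where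
`tube c = {U | ∀ p, c_p < P_p(U)}`, `P_p(U) = Re tr ρ(U_p)`, and `ρ'` is Lebesgue measure on `ℝ^𝒫` with density
`(∏_p β e^{β c_p}) · Haar(tube c)` (Edwards–Sokal 1988 for lattice gauge theory).

* §1 `∫_{x<a} β e^{βx} dx = e^{βa}` and its product form over the plaquettes (`integral_fintype_prod_eq_prod`);
* §2 the abstract Fubini identity `∫ F e^{β Σ_p P_p} dμ = ∫ (∏ βe^{βc_p}) (∫_{tube c} F dμ) dc` for bounded measurable
  levels on a finite measure space (`integral_mul_exp_sum_eq`; integrability from the bound `P_p ≤ M`);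
* §3 continuity of the levels and `e^{-βS} = e^{-βN#𝒫} e^{βΣP}` for the Wilson action;
* §4 the item: the Wilson integral is `Z⁻¹ e^{-βN#𝒫} ∫ F e^{βΣP} dHaar`, the normalisation is read off `F ≡ 1`,
  the density `ρ'` has total mass `ofReal (∫ e^{βΣP} dHaar)` (same identity at `F ≡ 1`), and the conditional Haar
  measures of null tubes are zero.

Pure measure theory on a finite torus; no crux, rung or summit is proved here and the YM mass gap is NOT proved.
-/

set_option autoImplicit false

namespace Summit.QuantumFields.YangMills.Theorems.RandomConstraintAnnealing

open MeasureTheory ProbabilityTheory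
open Literature.MathematicalPhysics.QuantumFieldTheory

/-! ## §1 The one-dimensional Edwards–Sokal integral and its product form -/

/-- `∫_{x < a} β e^{βx} dx = e^{βa}` for `β > 0`. -/
theorem integral_indicator_Iio_exp_mul {β : ℝ} (hβ : 0 < β) (a : ℝ) :
    ∫ x, Set.indicator (Set.Iio a) (fun x => β * Real.exp (β * x)) x = Real.exp (β * a) := by
  rw [integral_indicator measurableSet_Iio, ← integral_Iic_eq_integral_Iio, integral_const_mul,
    integral_exp_mul_Iic hβ, mul_div_cancel₀ _ hβ.ne']

/-- The indicator of `(-∞, a)` times `β e^{βx}` is integrable. -/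
theorem integrable_indicator_Iio_exp_mul {β : ℝ} (hβ : 0 < β) (a : ℝ) :
    Integrable (fun x => Set.indicator (Set.Iio a) (fun x => β * Real.exp (β * x)) x) := by
  rw [integrable_indicator_iff measurableSet_Iio]
  exact ((integrableOn_exp_mul_Iic hβ a).mono_set Set.Iio_subset_Iic_self).const_mul β

/-- PRODUCT FORM: for a finite index type `ι` and levels `P p`,
`∫_{ℝ^ι} ∏_p 𝟙[c_p < P_p] β e^{β c_p} dc = exp(β Σ_p P_p)`. -/
theorem integral_prod_indicator_exp_mul {ι : Type*} [Fintype ι] {β : ℝ} (hβ : 0 < β) (P : ι → ℝ) :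
    ∫ c : ι → ℝ, ∏ p, Set.indicator (Set.Iio (P p)) (fun x => β * Real.exp (β * x)) (c p)
        ∂(Measure.pi fun _ => (volume : Measure ℝ)) = Real.exp (β * ∑ p, P p) := by
  rw [integral_fintype_prod_eq_prod (fun p x => Set.indicator (Set.Iio (P p)) (fun x => β * Real.exp (β * x)) x)]
  simp_rw [integral_indicator_Iio_exp_mul hβ]
  rw [← Real.exp_sum, Finset.mul_sum]

/-- The product integrand is integrable on `ℝ^ι`. -/
theorem integrable_prod_indicator_exp_mul {ι : Type*} [Fintype ι] {β : ℝ} (hβ : 0 < β) (P : ι → ℝ) :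
    Integrable (fun c : ι → ℝ => ∏ p, Set.indicator (Set.Iio (P p)) (fun x => β * Real.exp (β * x)) (c p))
      (Measure.pi fun _ => (volume : Measure ℝ)) :=
  Integrable.fintype_prod (f := fun p x => Set.indicator (Set.Iio (P p)) (fun x => β * Real.exp (β * x)) x)
    fun p => integrable_indicator_Iio_exp_mul hβ (P p)

/-- The product of indicators is the indicator of the tube: `∏_p 𝟙[c_p < P_p] β e^{β c_p} = 𝟙[∀ p, c_p < P_p] ∏_p β e^{β c_p}`. -/
theorem prod_indicator_eq {ι : Type*} [Fintype ι] (β : ℝ) (P : ι → ℝ) (c : ι → ℝ) :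
    ∏ p, Set.indicator (Set.Iio (P p)) (fun x => β * Real.exp (β * x)) (c p) =
      if ∀ p, c p < P p then ∏ p, β * Real.exp (β * c p) else 0 := by
  classical
  split_ifs with h
  · exact Finset.prod_congr rfl fun p _ => Set.indicator_of_mem (Set.mem_Iio.2 (h p)) _
  · push Not at h
    obtain ⟨p, hp⟩ := h
    exact Finset.prod_eq_zero (Finset.mem_univ p) (Set.indicator_of_notMem (by simpa using hp) _)

/-! ## §2 The Edwards–Sokal Fubini identity (abstract form) -/

/-- The tube `{U | ∀ p, c_p < P_p(U)}` is measurable. -/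
theorem measurableSet_tube {Ω ι : Type*} [MeasurableSpace Ω] [Fintype ι] (P : Ω → ι → ℝ)
    (hPm : ∀ p, Measurable (fun U => P U p)) (c : ι → ℝ) : MeasurableSet {U | ∀ p, c p < P U p} := by
  have h : {U | ∀ p, c p < P U p} = ⋂ p, {U | c p < P U p} := by ext U; simp
  rw [h]
  exact MeasurableSet.iInter fun p => measurableSet_lt measurable_const (hPm p)

/-- The joint tube `{(c, U) | ∀ p, c_p < P_p(U)}` is measurable. -/
theorem measurableSet_jointTube {Ω ι : Type*} [MeasurableSpace Ω] [Fintype ι] (P : Ω → ι → ℝ)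
    (hPm : ∀ p, Measurable (fun U => P U p)) :
    MeasurableSet {z : (ι → ℝ) × Ω | ∀ p, z.1 p < P z.2 p} := by
  have h : {z : (ι → ℝ) × Ω | ∀ p, z.1 p < P z.2 p} = ⋂ p, {z | z.1 p < P z.2 p} := by ext z; simp
  rw [h]
  exact MeasurableSet.iInter fun p =>
    measurableSet_lt ((measurable_pi_apply p).comp measurable_fst) ((hPm p).comp measurable_snd)

/-- **EDWARDS–SOKAL FUBINI IDENTITY (abstract form).**  On a finite measure space, for bounded measurable
levels `P_p ≤ M` and a bounded measurable `F`:
`∫ F(U) e^{β Σ_p P_p(U)} dμ(U) = ∫_{ℝ^𝒫} (∏_p β e^{β c_p}) · (∫_{∀p, c_p < P_p(U)} F dμ) dc`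
— from `e^{βP} = ∫_{c<P} βe^{βc} dc`, the product formula and Fubini. -/
theorem integral_mul_exp_sum_eq {Ω ι : Type*} [MeasurableSpace Ω] [Fintype ι] (μ : Measure Ω)
    [IsFiniteMeasure μ] {β : ℝ} (hβ : 0 < β) (P : Ω → ι → ℝ) (hPm : ∀ p, Measurable (fun U => P U p))
    {M : ℝ} (hPb : ∀ U p, P U p ≤ M) (F : Ω → ℝ) (hFm : Measurable F) {K : ℝ} (hFb : ∀ U, |F U| ≤ K) :
    ∫ U, F U * Real.exp (β * ∑ p, P U p) ∂μ =
      ∫ c : ι → ℝ, (∏ p, β * Real.exp (β * c p)) * ∫ U in {U | ∀ p, c p < P U p}, F U ∂μ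
        ∂(Measure.pi fun _ => (volume : Measure ℝ)) := by
  set ν : Measure (ι → ℝ) := Measure.pi fun _ => (volume : Measure ℝ) with hν
  set f : ℝ → ℝ := fun x => β * Real.exp (β * x) with hf
  have hf0 : ∀ x, 0 ≤ f x := fun x => by rw [hf]; positivity
  have hfm : Measurable f := by rw [hf]; fun_prop
  set g : Ω → (ι → ℝ) → ℝ := fun U c => ∏ p, Set.indicator (Set.Iio (P U p)) f (c p) with hg
  have hg0 : ∀ U c, 0 ≤ g U c := fun U c => Finset.prod_nonneg fun p _ => Set.indicator_nonneg (fun x _ => hf0 x) _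
  have hgM : ∀ U c, g U c ≤ ∏ p, Set.indicator (Set.Iio M) f (c p) := fun U c =>
    Finset.prod_le_prod (fun p _ => Set.indicator_nonneg (fun x _ => hf0 x) _) fun p _ =>
      Set.indicator_le_indicator_of_subset (Set.Iio_subset_Iio (hPb U p)) (fun x => hf0 x) _
  have h1 : ∀ U, F U * Real.exp (β * ∑ p, P U p) = ∫ c, F U * g U c ∂ν := by
    intro U; rw [integral_const_mul, hg, hν, integral_prod_indicator_exp_mul hβ]
  have hgm : Measurable (Function.uncurry fun U c => F U * g U c) := by
    have e : (Function.uncurry fun U c => F U * g U c) =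
        fun z : Ω × (ι → ℝ) => F z.1 * ∏ p, if z.2 p < P z.1 p then f (z.2 p) else 0 := by
      funext z; simp only [Function.uncurry, hg, Set.indicator_apply, Set.mem_Iio]
    rw [e]
    refine (hFm.comp measurable_fst).mul (Finset.measurable_prod _ fun p _ => ?_)
    exact Measurable.ite (measurableSet_lt ((measurable_pi_apply p).comp measurable_snd)
      ((hPm p).comp measurable_fst)) (hfm.comp ((measurable_pi_apply p).comp measurable_snd))
      measurable_const
  have hint : Integrable (Function.uncurry fun U c => F U * g U c) (μ.prod ν) := by
    refine Integrable.mono' ((integrable_const K).mul_prod (integrable_prod_indicator_exp_mul hβ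
      (fun _ : ι => M))) hgm.aestronglyMeasurable (Filter.Eventually.of_forall fun z => ?_)
    rw [Function.uncurry_apply_pair, Real.norm_eq_abs, abs_mul, abs_of_nonneg (hg0 _ _)]
    exact mul_le_mul (hFb z.1) (hgM z.1 z.2) (hg0 _ _) ((abs_nonneg _).trans (hFb z.1))
  simp_rw [h1]
  rw [integral_integral_swap hint]
  refine integral_congr_ae (Filter.Eventually.of_forall fun c => ?_)
  have e2 : (fun U => F U * g U c) =
      fun U => Set.indicator {U | ∀ p, c p < P U p} (fun U => (∏ p, β * Real.exp (β * c p)) * F U) U := by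
    funext U
    rw [hg]
    change F U * ∏ p, Set.indicator (Set.Iio (P U p)) (fun x => β * Real.exp (β * x)) (c p) = _
    rw [prod_indicator_eq β (P U) c, Set.indicator_apply]
    simp only [Set.mem_setOf_eq]
    by_cases h : ∀ p, c p < P U p
    · rw [if_pos h, if_pos h, mul_comm]
    · rw [if_neg h, if_neg h, mul_zero]
  change ∫ U, F U * g U c ∂μ = _
  rw [e2, integral_indicator (measurableSet_tube P hPm c), integral_const_mul]

/-! ## §3 The Wilson measure -/

section Wilson

variable {d L N : ℕ} [NeZero L] {G : Type} [Group G] [TopologicalSpace G] [IsTopologicalGroup G]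
  [CompactSpace G] [SecondCountableTopology G] [MeasurableSpace G] [BorelSpace G]
  (ρ : G →* Matrix (Fin N) (Fin N) ℂ)

omit [NeZero L] [CompactSpace G] [SecondCountableTopology G] [MeasurableSpace G] [BorelSpace G] in
/-- The plaquette levels `P_p(U) = Re tr ρ(U_p)` are continuous in the configuration. -/
theorem continuous_plaqLevel (hρ : Continuous ρ) (p : Plaquette d L) :
    Continuous fun U : GaugeConfig d L G => (ρ (plaquetteHolonomy U p.1 p.2.1.1 p.2.1.2)).trace.re := by
  refine Complex.continuous_re.comp ((continuous_id.matrix_trace).comp (hρ.comp ?_))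
  unfold plaquetteHolonomy
  have hev : ∀ e : Edge d L, Continuous fun U : GaugeConfig d L G => U e := fun e => continuous_apply e
  exact (((hev _).mul (hev _)).mul (hev _).inv).mul (hev _).inv

omit [TopologicalSpace G] [IsTopologicalGroup G] [CompactSpace G] [SecondCountableTopology G] [MeasurableSpace G]
  [BorelSpace G] in
/-- `e^{-β S(U)} = e^{-β N #𝒫} · e^{β Σ_p P_p(U)}`. -/
theorem exp_neg_mul_wilsonAction (β : ℝ) (U : GaugeConfig d L G) :
    Real.exp (-β * wilsonAction ρ U) = Real.exp (-β * (N * Fintype.card (Plaquette d L))) *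
      Real.exp (β * ∑ p : Plaquette d L, (ρ (plaquetteHolonomy U p.1 p.2.1.1 p.2.1.2)).trace.re) := by
  rw [← Real.exp_add]
  congr 1
  simp only [wilsonAction, Finset.sum_sub_distrib, Finset.sum_const, Finset.card_univ, nsmul_eq_mul]
  ring

end Wilson

/-! ## §4 The route item -/

/-- **Route item `RandomConstraintAnnealing.EdwardsSokalDisintegration` (stmt-QuantumFields-8719):** the Edwards–Sokal
representation of the Wilson measure — `∫ F dμ_{Wilson} = ∫ (∫ F d Haar[· | tube c]) dρ'(c) / ρ'(univ)` with
`ρ'(dc) = (∏_p β e^{β c_p}) · Haar(tube c) dc`, `tube c = {U | ∀ p, c_p < Re tr ρ(U_p)}`, and `0 < ρ'(univ) < ∞`. -/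
theorem edwardsSokalDisintegration_proof :
    Summit.QuantumFields.YangMills.Theses.RandomConstraintAnnealing.EdwardsSokalDisintegration := by
  intro d L N _ G _ _ _ _ _ _ _ _ ρ hρ β hβ F hFm hFb P haar tube ρ'
  obtain ⟨K, hK⟩ := hFb
  set ν : Measure (Plaquette d L → ℝ) := Measure.pi fun _ : Plaquette d L => (volume : Measure ℝ) with hν
  set w : (Plaquette d L → ℝ) → ENNReal :=
    fun c => ENNReal.ofReal (∏ p, β * Real.exp (β * c p)) * haar (tube c) with hw
  have hρ'def : ρ' = ν.withDensity w := rfl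
  haveI : IsProbabilityMeasure haar := by
    change IsProbabilityMeasure (Measure.pi fun _ : Edge d L => haarProbability G); infer_instance
  have hPm : ∀ p, Measurable fun U => P U p := fun p => (continuous_plaqLevel (d := d) (L := L) ρ hρ p).measurable
  have habs : ∀ U p, |P U p| ≤ (N : ℝ) := fun U p => by
    simpa using Literature.RepresentationTheory.CompactGroups.CompactGroup.abs_re_trace_le_card ρ hρ
      (plaquetteHolonomy U p.1 p.2.1.1 p.2.1.2)
  have hPb : ∀ U p, P U p ≤ (N : ℝ) := fun U p => (abs_le.1 (habs U p)).2
  have hprod0 : ∀ c : Plaquette d L → ℝ, 0 ≤ ∏ p, β * Real.exp (β * c p) := fun c =>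
    Finset.prod_nonneg fun p _ => by positivity
  have hprod_m : Measurable fun c : Plaquette d L → ℝ => ∏ p, β * Real.exp (β * c p) :=
    Finset.measurable_prod _ fun p _ => by
      have hp : Measurable fun c : Plaquette d L → ℝ => c p := measurable_pi_apply p
      exact (hp.const_mul β).exp.const_mul β
  -- the Edwards–Sokal Fubini identity for the product Haar measure
  have hES : ∀ (Φ : GaugeConfig d L G → ℝ) (KΦ : ℝ), Measurable Φ → (∀ U, |Φ U| ≤ KΦ) →
      ∫ U, Φ U * Real.exp (β * ∑ p, P U p) ∂haar =
        ∫ c, (∏ p, β * Real.exp (β * c p)) * ∫ U in tube c, Φ U ∂haar ∂ν :=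
    fun Φ KΦ hΦm hΦb => integral_mul_exp_sum_eq haar hβ P hPm hPb Φ hΦm hΦb
  -- the Wilson integral as a Haar integral
  have hSm : Measurable (wilsonAction (d := d) (L := L) (G := G) ρ) := by
    change Measurable fun U : GaugeConfig d L G => ∑ p : Plaquette d L, ((N : ℝ) - P U p)
    exact Finset.measurable_sum _ fun p _ => measurable_const.sub (hPm p)
  have hexpS : ∀ U : GaugeConfig d L G, Real.exp (-β * wilsonAction ρ U) =
      Real.exp (-β * (N * Fintype.card (Plaquette d L))) * Real.exp (β * ∑ p, P U p) :=
    fun U => exp_neg_mul_wilsonAction ρ β U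
  have hW : ∀ (Φ : GaugeConfig d L G → ℝ), ∫ U, Φ U ∂(wilsonMeasure ρ β) =
      ((partitionFunction (d := d) (L := L) ρ β)⁻¹).toReal *
        (Real.exp (-β * (N * Fintype.card (Plaquette d L))) * ∫ U, Φ U * Real.exp (β * ∑ p, P U p) ∂haar) := by
    intro Φ
    change ∫ U, Φ U ∂((partitionFunction ρ β)⁻¹ • wilsonWeight ρ β) = _
    rw [integral_smul_measure, smul_eq_mul]
    congr 1
    change ∫ U, Φ U ∂(haar.withDensity fun U => ENNReal.ofReal (Real.exp (-β * wilsonAction ρ U))) = _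
    have hdm : Measurable (fun U : GaugeConfig d L G => ENNReal.ofReal (Real.exp (-β * wilsonAction ρ U))) :=
      ENNReal.measurable_ofReal.comp ((hSm.const_mul (-β)).exp)
    rw [integral_withDensity_eq_integral_toReal_smul hdm (ae_of_all _ fun _ => ENNReal.ofReal_lt_top),
      ← integral_const_mul]
    refine integral_congr_ae (ae_of_all _ fun U => ?_)
    beta_reduce
    rw [ENNReal.toReal_ofReal (Real.exp_nonneg _), smul_eq_mul, hexpS U]
    ring
  -- `I₁ = ∫ e^{β Σ P} dHaar > 0` and the normalisation `Z⁻¹ e^{-βN#𝒫} I₁ = 1`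
  set I1 : ℝ := ∫ U, Real.exp (β * ∑ p, P U p) ∂haar with hI1
  have hEm : Measurable fun U : GaugeConfig d L G => Real.exp (β * ∑ p, P U p) :=
    ((Finset.measurable_sum _ fun p _ => hPm p).const_mul β).exp
  have hElb : ∀ U, Real.exp (-(β * (N * Fintype.card (Plaquette d L)))) ≤ Real.exp (β * ∑ p, P U p) := by
    intro U
    refine Real.exp_le_exp.2 ?_
    have h1 : ∑ _p : Plaquette d L, (-(N : ℝ)) ≤ ∑ p, P U p :=
      Finset.sum_le_sum fun p _ => (abs_le.1 (habs U p)).1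
    rw [Finset.sum_const, Finset.card_univ, nsmul_eq_mul] at h1
    nlinarith [h1, hβ]
  have hEub : ∀ U, |Real.exp (β * ∑ p, P U p)| ≤ Real.exp (β * (N * Fintype.card (Plaquette d L))) := by
    intro U
    rw [abs_of_nonneg (Real.exp_nonneg _)]
    refine Real.exp_le_exp.2 (mul_le_mul_of_nonneg_left ?_ hβ.le)
    have h1 : ∑ p, P U p ≤ ∑ _p : Plaquette d L, (N : ℝ) := Finset.sum_le_sum fun p _ => hPb U p
    rwa [Finset.sum_const, Finset.card_univ, nsmul_eq_mul, mul_comm] at h1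
  have hEint : Integrable (fun U => Real.exp (β * ∑ p, P U p)) haar :=
    Integrable.mono' (integrable_const _) hEm.aestronglyMeasurable (ae_of_all _ fun U => by
      rw [Real.norm_eq_abs]; exact hEub U)
  have hI1pos : 0 < I1 := by
    have h := integral_mono (integrable_const (Real.exp (-(β * (N * Fintype.card (Plaquette d L)))))) hEint hElb
    simp only [integral_const, probReal_univ, one_smul] at h
    exact lt_of_lt_of_le (Real.exp_pos _) h
  haveI := isProbabilityMeasure_wilsonMeasure (d := d) (L := L) ρ hρ β
  have hκ1 : ((partitionFunction (d := d) (L := L) ρ β)⁻¹).toReal *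
      Real.exp (-β * (N * Fintype.card (Plaquette d L))) * I1 = 1 := by
    have h := hW (fun _ => 1)
    simp only [integral_const, probReal_univ, one_smul, one_mul] at h
    rw [← hI1] at h
    rw [mul_assoc]
    exact h.symm
  have hWF : ∫ U, F U ∂(wilsonMeasure ρ β) = (∫ U, F U * Real.exp (β * ∑ p, P U p) ∂haar) / I1 := by
    rw [hW F, ← mul_assoc, eq_inv_of_mul_eq_one_left hκ1, inv_mul_eq_div]
  -- the density `w`: measurable, finite, total mass `ofReal I₁`
  have hhaar_tube_m : Measurable fun c => haar (tube c) := by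
    have e : (fun c => haar (tube c)) = fun c => haar (Prod.mk c ⁻¹'
        {z : (Plaquette d L → ℝ) × GaugeConfig d L G | ∀ p, z.1 p < P z.2 p}) := rfl
    rw [e]
    exact measurable_measure_prodMk_left (measurableSet_jointTube P hPm)
  have hw_m : Measurable w := (ENNReal.measurable_ofReal.comp hprod_m).mul hhaar_tube_m
  have hw_lt : ∀ c, w c < ⊤ := fun c => ENNReal.mul_lt_top ENNReal.ofReal_lt_top (measure_lt_top _ _)
  have hw_eq : ∀ c, w c = ENNReal.ofReal ((∏ p, β * Real.exp (β * c p)) * (haar (tube c)).toReal) := by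
    intro c
    rw [ENNReal.ofReal_mul (hprod0 c), ENNReal.ofReal_toReal (measure_ne_top _ _)]
  have hwt0 : ∀ c, 0 ≤ (∏ p, β * Real.exp (β * c p)) * (haar (tube c)).toReal := fun c =>
    mul_nonneg (hprod0 c) ENNReal.toReal_nonneg
  have hw_toReal : ∀ c, (w c).toReal = (∏ p, β * Real.exp (β * c p)) * (haar (tube c)).toReal := by
    intro c; rw [hw_eq, ENNReal.toReal_ofReal (hwt0 c)]
  have hJ1 : ∫ c, (∏ p, β * Real.exp (β * c p)) * (haar (tube c)).toReal ∂ν = I1 := by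
    have h := hES (fun _ => 1) 1 measurable_const (fun _ => by simp)
    simp only [one_mul] at h
    rw [hI1, h]
    refine integral_congr_ae (ae_of_all _ fun c => ?_)
    simp only [integral_const, smul_eq_mul, mul_one, Measure.real, Measure.restrict_apply MeasurableSet.univ,
      Set.univ_inter]
  have hwt_int : Integrable (fun c => (∏ p, β * Real.exp (β * c p)) * (haar (tube c)).toReal) ν := by
    refine Integrable.mono' (integrable_prod_indicator_exp_mul hβ (fun _ : Plaquette d L => (N : ℝ)))
      (hprod_m.mul hhaar_tube_m.ennreal_toReal).aestronglyMeasurable (ae_of_all _ fun c => ?_)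
    rw [Real.norm_eq_abs, abs_of_nonneg (hwt0 c)]
    by_cases hc : ∀ p, c p < (N : ℝ)
    · rw [prod_indicator_eq, if_pos hc]
      exact mul_le_of_le_one_right (hprod0 c) (ENNReal.toReal_le_of_le_ofReal zero_le_one
        (by rw [ENNReal.ofReal_one]; exact prob_le_one))
    · have hempty : tube c = ∅ := by
        ext U
        simp only [Set.mem_empty_iff_false, iff_false]
        intro hU
        apply hc
        intro p
        exact lt_of_lt_of_le (hU p) (hPb U p)
      rw [hempty, measure_empty, ENNReal.toReal_zero, mul_zero]
      exact Finset.prod_nonneg fun p _ => Set.indicator_nonneg (fun _ _ => by positivity) _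
  have hlint : ∫⁻ c, w c ∂ν = ENNReal.ofReal I1 := by
    rw [← hJ1, ofReal_integral_eq_lintegral_ofReal hwt_int (ae_of_all _ hwt0)]
    exact lintegral_congr fun c => hw_eq c
  have hρ'univ : ρ' Set.univ = ENNReal.ofReal I1 := by
    rw [hρ'def, withDensity_apply _ MeasurableSet.univ, Measure.restrict_univ, hlint]
  -- the right-hand side
  have hRHS : ∫ c, (∫ U, F U ∂(ProbabilityTheory.cond haar (tube c))) ∂((ρ' Set.univ)⁻¹ • ρ') =
      (∫ U, F U * Real.exp (β * ∑ p, P U p) ∂haar) / I1 := by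
    rw [integral_smul_measure, hρ'univ, ENNReal.toReal_inv, ENNReal.toReal_ofReal hI1pos.le, smul_eq_mul,
      hρ'def, integral_withDensity_eq_integral_toReal_smul hw_m (ae_of_all _ hw_lt), hES F K hFm hK,
      inv_mul_eq_div]
    congr 1
    refine integral_congr_ae (ae_of_all _ fun c => ?_)
    beta_reduce
    rw [hw_toReal c, smul_eq_mul]
    change _ * ∫ U, F U ∂((haar (tube c))⁻¹ • haar.restrict (tube c)) = _
    rw [integral_smul_measure, smul_eq_mul, ENNReal.toReal_inv]
    by_cases h0 : haar (tube c) = 0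
    · rw [Measure.restrict_eq_zero.2 h0, integral_zero_measure, h0]
      simp
    · have hne : (haar (tube c)).toReal ≠ 0 := ENNReal.toReal_ne_zero.2 ⟨h0, measure_ne_top _ _⟩
      rw [mul_assoc, ← mul_assoc (haar (tube c)).toReal, mul_inv_cancel₀ hne, one_mul]
  refine ⟨⟨?_, ?_⟩, ?_⟩
  · rw [hρ'univ]; exact ENNReal.ofReal_pos.2 hI1pos
  · rw [hρ'univ]; exact ENNReal.ofReal_lt_top
  · rw [hWF, hRHS]

end Summit.QuantumFields.YangMills.Theorems.RandomConstraintAnnealing
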